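import Mathlib
import Summits.MatrixMultiplication.MatrixMultiplication.Theses.FourierTwoFamiliesModP
import Summits.MatrixMultiplication.MatrixMultiplication.Theorems.PrimeTwoFamilies.Negative.Slices
import Summits.MatrixMultiplication.MatrixMultiplication.Theorems.FourierTwoFamiliesModPCyclicReductionTransfer
import Summits.MatrixMultiplication.MatrixMultiplication.Theorems.FourierTwoFamiliesModPPrimeTwoFamiliesCapacityLift

/-!
# Gadget merit `(θ, γ)` to slices `δ` of `PrimeTwoFamilies`: the explicit exchange rate (support file)

Item `stmt-MatrixMultiplication-14308` (`FourierTwoFamiliesModP.PrimeTwoFamilies`, CKSU 2005 Conj. 4.7 with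
prime cyclic hosts), line `Sketch` (capacity-gadget skeleton `Cruxes/PrimeTwoFamilies/Lines/Sketch.lean`),
registered stub `primeTwoFamiliesAt_of_capacityGadgets`; siege variation "explicit / elementary".

The capacity line measures a gadget level — direct pairs `(P c, Q c)_{c<r}` in `ℤ/m` and a zero-error
code `W` of words `Fin L → Fin r` — by two exponents: the RATE `θ` (`|W| ≥ (m ^ L) ^ θ`) and the
CO-VOLUME `γ` (`|P c||Q c| ≥ m ^ γ`).  The tree's transfer statements fix `(θ, γ) = (1/2 - ε, 1 - ε)` and
quantify over all `ε > 0` (`CapacityLift.primeTwoFamiliesAt_of_capacityGadgets`, `stub_capacityTransfer`,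
with the admissible `ε` for a slice `δ ≤ 1` hidden in an `∃`).  This file makes the exchange rate explicit
and two-dimensional:

* `primeTwoFamiliesAt_of_gadgetsAt` — gadget levels of merit `(θ, γ)` at arbitrarily large `m` give the
  slice `PrimeTwoFamiliesAt δ` for every `δ > 0` with

    `θ (2 + δ) > 1`  and  `θ (2 - δ) < γ`;

  since the rate hypothesis is monotone in `θ`, a census point `(θ, γ)` serves by this theorem the slices
  `δ > max (1/θ - 2, 2 (1 - γ)/(1 + γ))`.  Consistency checks: honest SDPP families are the case `L = 1`
  (clause (X) is strong separation of one-letter words), and translate levels `(θ, γ) = (1 - γ, γ)` give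
  `max (1/(1-γ) - 2, 2 (1-γ)/(1+γ)) ≥ 1/2` with equality at `γ = 3/5`, i.e. the slices `δ > 1/2` of the
  known baseline `Negative.primeTwoFamiliesAt_of_gt_half`; the crux (`δ → 0`) forces `(θ, γ) → (1/2, 1)`.
* `primeTwoFamiliesAt_of_capacityGadgetsAt` — the one-parameter form: gadgets at ONE defect `ε ≥ 0` give
  the slice `δ` as soon as `(1/2 - ε)(2 + δ) > 1`, i.e. `δ > 4ε/(1 - 2ε)` (the co-volume condition is then
  automatic: `(1 - ε) - (1/2 - ε)(2 - δ) = ((1/2 - ε)(2 + δ) - 1) + 3ε > 0`).  In particular gadgets at any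
  fixed defect `ε < 1/10` would already beat the translate baseline `δ > 1/2`.
* `primeTwoFamiliesAt_of_capacityGadgets` — the registered stub verbatim, as the corollary `ε = δ/8`.

The bookkeeping is elementary and root-free: with `M = m ^ L` keep `n = ⌈M ^ θ⌉₊ ≤ |W|` blocks; the host
prime is `p ≤ 2·3^L·m^L ≤ 6^L · M ≤ M ^ (θ (2+δ)) ≤ n ^ (2+δ)` once `m ^ κ ≥ 6`, `κ = θ (2+δ) - 1`; and
`n ^ (2-δ) ≤ (2 M ^ θ) ^ (2-δ) ≤ 4 M ^ (θ (2-δ)) ≤ M ^ γ = (m ^ γ) ^ L ≤ |A_w||B_w|` once `m ^ μ ≥ 4`,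
`μ = γ - θ (2-δ)`; finally `n ≥ m ^ θ ≥ n₀`.  The thresholds are uniform in the word length `L ≥ 1`.
Tree tools used: the code lift `CapacityLift.codeLift` (product blocks over a zero-error code satisfy
(W), (X)) and the carry-free transfer `exists_prime_sdpp_of_addEquiv` (route support `CyclicReduction`).
-/

-- single-conjunct summit: the mandated namespace repeats `MatrixMultiplication` (summit = sub-problem).
set_option linter.dupNamespace false

namespace Summit.MatrixMultiplication.MatrixMultiplication.Theorems.PrimeTwoFamilies.GadgetExchangeRate

open Finset Filter
open Summit.MatrixMultiplication.MatrixMultiplication.Theses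
open Summit.MatrixMultiplication.MatrixMultiplication.Theorems
open Summit.MatrixMultiplication.MatrixMultiplication.Theorems.PrimeTwoFamilies.Negative
open Summit.MatrixMultiplication.MatrixMultiplication.Theorems.PrimeTwoFamilies.CapacityLift

/-- A real power with positive exponent of a natural number is eventually above any constant:
for `0 < a` there is `m₀` with `K ≤ m ^ a` for all naturals `m ≥ m₀`. -/
private theorem exists_le_rpow (K a : ℝ) (ha : 0 < a) :
    ∃ m₀ : ℕ, ∀ m : ℕ, m₀ ≤ m → K ≤ (m : ℝ) ^ a := by
  have h : Tendsto (fun m : ℕ => (m : ℝ) ^ a) atTop atTop :=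
    (tendsto_rpow_atTop ha).comp tendsto_natCast_atTop_atTop
  exact eventually_atTop.1 (h.eventually_ge_atTop K)

/-- **Gadget merit `(θ, γ)` to slices: the explicit exchange rate.**  Let `δ > 0`, `θ (2 + δ) > 1` and
`θ (2 - δ) < γ`.  If for arbitrarily large `m` there are direct pairs `(P c, Q c)_{c<r}` in `ZMod m` of
co-volume `m ^ γ ≤ |P c||Q c|` and a zero-error code `W` of words `Fin L → Fin r` (`1 ≤ L`, every
ordered pair of distinct words strongly separated in some coordinate) of rate `(m ^ L) ^ θ ≤ |W|`, then
the slice `PrimeTwoFamiliesAt δ` holds.  Witness: `n = ⌈(m ^ L) ^ θ⌉₊` product blocks (`codeLift`) moved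
into a Bertrand prime `p ≤ 2·3^L·m^L` by the carry-free transfer `exists_prime_sdpp_of_addEquiv`;
thresholds `m ^ κ ≥ 6`, `m ^ μ ≥ 4`, `m ^ θ ≥ n₀` with `κ = θ (2+δ) - 1`, `μ = γ - θ (2-δ)`.
(Slices `δ > 2` hold trivially, `primeTwoFamiliesAt_two`.) -/
theorem primeTwoFamiliesAt_of_gadgetsAt {δ θ γ : ℝ} (hδ : 0 < δ) (hκ : 1 < θ * (2 + δ))
    (hμ : θ * (2 - δ) < γ)
    (hC : ∀ m₀ : ℕ, ∃ m ≥ m₀, ∃ r L : ℕ, ∃ P Q : Fin r → Finset (ZMod m),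
      ∃ W : Finset (Fin L → Fin r),
      (∀ c : Fin r, ∀ x ∈ P c, ∀ x' ∈ P c, ∀ y ∈ Q c, ∀ y' ∈ Q c,
          (x - x') + (y - y') = 0 → x = x' ∧ y = y') ∧
      (∀ i ∈ W, ∀ k ∈ W, i ≠ k → ∃ t : Fin L,
        ∀ p ∈ P (i t), ∀ q ∈ Q (k t), ∀ c : Fin r, ∀ p' ∈ P c, ∀ q' ∈ Q c, q - p ≠ q' - p') ∧
      1 ≤ L ∧
      ((m : ℝ) ^ (L : ℝ)) ^ θ ≤ (W.card : ℝ) ∧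
      ∀ c : Fin r, (m : ℝ) ^ γ ≤ (((P c).card * (Q c).card : ℕ) : ℝ)) :
    PrimeTwoFamiliesAt δ := by
  -- far slices are trivial
  rcases lt_or_ge 2 δ with hδ2 | hδ2
  · exact primeTwoFamiliesAt_two.mono hδ2.le
  classical
  -- the exponents `κ, μ`
  have h2δ : (0 : ℝ) < 2 + δ := by linarith
  have hθ0 : 0 < θ := by
    by_contra hle
    nlinarith [mul_nonpos_of_nonpos_of_nonneg (not_lt.1 hle) h2δ.le]
  set κ : ℝ := θ * (2 + δ) - 1 with hκdef
  have hκ0 : 0 < κ := by linarith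
  set μ : ℝ := γ - θ * (2 - δ) with hμdef
  have hμ0 : 0 < μ := by linarith
  intro n₀
  -- thresholds on the gadget level `m`
  obtain ⟨m₁, hm₁⟩ := exists_le_rpow 6 κ hκ0
  obtain ⟨m₂, hm₂⟩ := exists_le_rpow 4 μ hμ0
  obtain ⟨m₃, hm₃⟩ := exists_le_rpow n₀ θ hθ0
  obtain ⟨m, hm, r, L, P, Q, W, hD, hCode, hL, hWcard, hcov⟩ := hC (max (max m₁ m₂) (max m₃ 2))
  have h6 : (6 : ℝ) ≤ (m : ℝ) ^ κ := hm₁ m (le_trans (le_trans (le_max_left _ _) (le_max_left _ _)) hm)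
  have h4 : (4 : ℝ) ≤ (m : ℝ) ^ μ := hm₂ m (le_trans (le_trans (le_max_right _ _) (le_max_left _ _)) hm)
  have hn₀ : (n₀ : ℝ) ≤ (m : ℝ) ^ θ :=
    hm₃ m (le_trans (le_trans (le_max_left _ _) (le_max_right _ _)) hm)
  have hm2 : 2 ≤ m := le_trans (le_trans (le_max_right _ _) (le_max_right _ _)) hm
  have hm1R : (1 : ℝ) ≤ m := by exact_mod_cast le_trans one_le_two hm2
  have hm0R : (0 : ℝ) ≤ m := zero_le_one.trans hm1R
  have hL0 : L ≠ 0 := by omega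
  -- `M = m ^ L`, `T = M ^ θ`, `n = ⌈T⌉₊`
  set M : ℝ := (m : ℝ) ^ (L : ℝ) with hMdef
  have hMnat : M = (m : ℝ) ^ L := Real.rpow_natCast _ _
  have hmM : (m : ℝ) ≤ M := by rw [hMnat]; exact le_self_pow₀ hm1R hL0
  have hM1 : 1 ≤ M := hm1R.trans hmM
  have hM0 : 0 ≤ M := zero_le_one.trans hM1
  have hMpos : 0 < M := zero_lt_one.trans_le hM1
  set T : ℝ := M ^ θ with hTdef
  have hT1 : 1 ≤ T := Real.one_le_rpow hM1 hθ0.le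
  have hT0 : 0 ≤ T := zero_le_one.trans hT1
  set n : ℕ := ⌈T⌉₊ with hndef
  have hTn : T ≤ n := Nat.le_ceil T
  have hn0 : (0 : ℝ) ≤ n := n.cast_nonneg
  have hn2T : (n : ℝ) ≤ 2 * T := by
    have h := Nat.ceil_lt_add_one hT0
    linarith
  have hnN : n ≤ W.card := Nat.ceil_le.2 hWcard
  have hn₀n : n₀ ≤ n := by
    have h : (n₀ : ℝ) ≤ n := hn₀.trans ((Real.rpow_le_rpow hm0R hmM hθ0.le).trans hTn)
    exact_mod_cast h
  -- powers of `m` raised to `L` are powers of `M`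
  have hpowL : ∀ η : ℝ, ((m : ℝ) ^ η) ^ L = M ^ η := fun η => by
    rw [← Real.rpow_mul_natCast hm0R, mul_comm η (L : ℝ), Real.rpow_mul hm0R]
  -- (1) the host bound: `2·3^L·m^L ≤ T ^ (2+δ) ≤ n ^ (2+δ)`
  have hhost : (2 : ℝ) * (3 ^ L * (m : ℝ) ^ L) ≤ (n : ℝ) ^ (2 + δ) := by
    have h36 : (2 : ℝ) * 3 ^ L ≤ 6 ^ L := by
      calc (2 : ℝ) * 3 ^ L ≤ 2 ^ L * 3 ^ L :=
            mul_le_mul_of_nonneg_right (le_self_pow₀ (by norm_num) hL0) (by positivity)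
        _ = 6 ^ L := by rw [← mul_pow]; norm_num
    have hMκ : (6 : ℝ) ^ L ≤ M ^ κ := by
      calc (6 : ℝ) ^ L ≤ ((m : ℝ) ^ κ) ^ L := pow_le_pow_left₀ (by norm_num) h6 L
        _ = M ^ κ := hpowL κ
    calc (2 : ℝ) * (3 ^ L * (m : ℝ) ^ L) = (2 * 3 ^ L) * M := by rw [hMnat]; ring
      _ ≤ M ^ κ * M := mul_le_mul_of_nonneg_right (h36.trans hMκ) hM0
      _ = M ^ (κ + 1) := by rw [Real.rpow_add hMpos, Real.rpow_one]
      _ = M ^ (θ * (2 + δ)) := by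
          congr 1
          rw [hκdef]
          ring
      _ = T ^ (2 + δ) := by rw [hTdef, ← Real.rpow_mul hM0]
      _ ≤ (n : ℝ) ^ (2 + δ) := Real.rpow_le_rpow hT0 hTn h2δ.le
  -- (2) the co-volume bound: `n ^ (2-δ) ≤ 4 M ^ (θ (2-δ)) ≤ M ^ γ = (m ^ γ) ^ L`
  have hnP : (n : ℝ) ^ (2 - δ) ≤ ((m : ℝ) ^ γ) ^ L := by
    have h2δ' : (0 : ℝ) ≤ 2 - δ := by linarith
    have h22 : (2 : ℝ) ^ (2 - δ) ≤ 4 := by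
      calc (2 : ℝ) ^ (2 - δ) ≤ 2 ^ (2 : ℝ) :=
            Real.rpow_le_rpow_of_exponent_le (by norm_num) (by linarith)
        _ = 4 := by norm_num
    have hMμ : (4 : ℝ) ≤ M ^ μ := by
      calc (4 : ℝ) ≤ (m : ℝ) ^ μ := h4
        _ ≤ ((m : ℝ) ^ μ) ^ L := le_self_pow₀ (le_trans (by norm_num) h4) hL0
        _ = M ^ μ := hpowL μ
    calc (n : ℝ) ^ (2 - δ) ≤ (2 * T) ^ (2 - δ) := Real.rpow_le_rpow hn0 hn2T h2δ'
      _ = 2 ^ (2 - δ) * T ^ (2 - δ) := Real.mul_rpow (by norm_num) hT0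
      _ ≤ 4 * T ^ (2 - δ) := mul_le_mul_of_nonneg_right h22 (Real.rpow_nonneg hT0 _)
      _ = 4 * M ^ (θ * (2 - δ)) := by rw [hTdef, ← Real.rpow_mul hM0]
      _ ≤ M ^ μ * M ^ (θ * (2 - δ)) := mul_le_mul_of_nonneg_right hMμ (Real.rpow_nonneg hM0 _)
      _ = M ^ (μ + θ * (2 - δ)) := (Real.rpow_add hMpos _ _).symm
      _ = M ^ γ := by
          congr 1
          rw [hμdef]
          ring
      _ = ((m : ℝ) ^ γ) ^ L := (hpowL γ).symm
  -- (3) the family: code lift over `W`, enumerated by `Fin N`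
  set N : ℕ := W.card with hN
  let e : W ≃ Fin N := W.equivFin
  let A : Fin N → Finset (Fin L → ZMod m) :=
    fun i => Fintype.piFinset (fun t => P ((e.symm i : Fin L → Fin r) t))
  let B : Fin N → Finset (Fin L → ZMod m) :=
    fun i => Fintype.piFinset (fun t => Q ((e.symm i : Fin L → Fin r) t))
  obtain ⟨hW1, hX1⟩ := codeLift P Q hD W hCode
  have hWA : ∀ i : Fin N, ∀ a ∈ A i, ∀ a' ∈ A i, ∀ b ∈ B i, ∀ b' ∈ B i,
      (a - a') + (b - b') = 0 → a = a' ∧ b = b' :=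
    fun i => hW1 _ (e.symm i).2
  have hXA : ∀ i j k : Fin N, ∀ a ∈ A i, ∀ a' ∈ A j, ∀ b ∈ B j, ∀ b' ∈ B k,
      (a - a') + (b - b') = 0 → i = k := by
    intro i j k a ha a' ha' b hb b' hb' h0
    have hik := hX1 _ (e.symm i).2 _ (e.symm j).2 _ (e.symm k).2 a ha a' ha' b hb b' hb' h0
    exact e.symm.injective (Subtype.ext hik)
  -- (4) transfer into a prime cyclic host and keep the first `n` blocks
  obtain ⟨p, hp, hpR, A', B', hcard, hW', hX'⟩ :=
    exists_prime_sdpp_of_addEquiv hWA hXA (m := fun _ : Fin L => m) (fun _ => by omega)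
      (AddEquiv.refl (Fin L → ZMod m))
  rw [Fin.prod_const] at hpR
  refine ⟨n, hn₀n, p, hp, A' ∘ Fin.castLE hnN, B' ∘ Fin.castLE hnN, ?_, ?_, ?_, ?_⟩
  · intro i
    exact hW' (Fin.castLE hnN i)
  · intro i j k a ha a' ha' b hb b' hb' h0
    exact Fin.castLE_injective hnN (hX' _ _ _ a ha a' ha' b hb b' hb' h0)
  · calc (p : ℝ) ≤ 2 * (3 ^ L * (m : ℝ) ^ L) := by exact_mod_cast hpR
      _ ≤ (n : ℝ) ^ (2 + δ) := hhost
  · intro i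
    have hci := hcard (Fin.castLE hnN i)
    simp only [Function.comp_apply]
    rw [hci.1, hci.2]
    simp only [A, B, Fintype.card_piFinset]
    rw [← Finset.prod_mul_distrib]
    refine hnP.trans ?_
    rw [← Fin.prod_const]
    push_cast
    refine Finset.prod_le_prod (fun t _ => by positivity) fun t _ => ?_
    exact_mod_cast hcov _

/-- **Capacity gadgets at one rate defect give a slice.**  Let `δ > 0`, `0 ≤ ε` and
`(1/2 - ε) (2 + δ) > 1` (equivalently `δ > 4ε / (1 - 2ε)`).  If for arbitrarily large `m` there are
direct pairs `(P c, Q c)_{c<r}` in `ZMod m` of co-volume `m ^ (1-ε) ≤ |P c||Q c|` and a zero-error code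
`W ⊆ (Fin L → Fin r)` (`1 ≤ L`) with `(m ^ L) ^ (1/2 - ε) ≤ |W|`, then `PrimeTwoFamiliesAt δ` holds: the
case `(θ, γ) = (1/2 - ε, 1 - ε)` of `primeTwoFamiliesAt_of_gadgetsAt`, whose co-volume condition
`(1/2 - ε)(2 - δ) < 1 - ε` is automatic (`= κ + 3ε > 0`). -/
theorem primeTwoFamiliesAt_of_capacityGadgetsAt {δ ε : ℝ} (hδ : 0 < δ) (hε : 0 ≤ ε)
    (hκ : 1 < (1 / 2 - ε) * (2 + δ))
    (hC : ∀ m₀ : ℕ, ∃ m ≥ m₀, ∃ r L : ℕ, ∃ P Q : Fin r → Finset (ZMod m),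
      ∃ W : Finset (Fin L → Fin r),
      (∀ c : Fin r, ∀ x ∈ P c, ∀ x' ∈ P c, ∀ y ∈ Q c, ∀ y' ∈ Q c,
          (x - x') + (y - y') = 0 → x = x' ∧ y = y') ∧
      (∀ i ∈ W, ∀ k ∈ W, i ≠ k → ∃ t : Fin L,
        ∀ p ∈ P (i t), ∀ q ∈ Q (k t), ∀ c : Fin r, ∀ p' ∈ P c, ∀ q' ∈ Q c, q - p ≠ q' - p') ∧
      1 ≤ L ∧
      ((m : ℝ) ^ (L : ℝ)) ^ (1 / 2 - ε) ≤ (W.card : ℝ) ∧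
      ∀ c : Fin r, (m : ℝ) ^ (1 - ε) ≤ (((P c).card * (Q c).card : ℕ) : ℝ)) :
    PrimeTwoFamiliesAt δ :=
  primeTwoFamiliesAt_of_gadgetsAt hδ hκ (by nlinarith) hC

/-- **Registered stub `primeTwoFamiliesAt_of_capacityGadgets`** (line `Sketch`, crux
`FourierTwoFamiliesModP.PrimeTwoFamilies`): capacity gadgets at every rate defect `ε > 0` give every slice
`0 < δ ≤ 1` of the crux.  The statement is the registered stub verbatim (it is also served by
`CapacityLift.primeTwoFamiliesAt_of_capacityGadgets`); here it is the corollary `ε = δ / 8` of the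
explicit exchange rate `primeTwoFamiliesAt_of_capacityGadgetsAt`, admissible because
`(1/2 - δ/8) (2 + δ) = 1 + δ (2 - δ) / 8 > 1` for `0 < δ ≤ 1`. -/
theorem primeTwoFamiliesAt_of_capacityGadgets
    (hC : ∀ ε : ℝ, 0 < ε → ∀ m₀ : ℕ, ∃ m ≥ m₀, ∃ r L : ℕ, ∃ P Q : Fin r → Finset (ZMod m),
      ∃ W : Finset (Fin L → Fin r),
      (∀ c : Fin r, ∀ x ∈ P c, ∀ x' ∈ P c, ∀ y ∈ Q c, ∀ y' ∈ Q c,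
          (x - x') + (y - y') = 0 → x = x' ∧ y = y') ∧
      (∀ i ∈ W, ∀ k ∈ W, i ≠ k → ∃ t : Fin L,
        ∀ p ∈ P (i t), ∀ q ∈ Q (k t), ∀ c : Fin r, ∀ p' ∈ P c, ∀ q' ∈ Q c, q - p ≠ q' - p') ∧
      1 ≤ L ∧
      ((m : ℝ) ^ (L : ℝ)) ^ (1 / 2 - ε) ≤ (W.card : ℝ) ∧
      ∀ c : Fin r, (m : ℝ) ^ (1 - ε) ≤ (((P c).card * (Q c).card : ℕ) : ℝ))
    {δ : ℝ} (hδ : 0 < δ) (hδ1 : δ ≤ 1) : PrimeTwoFamiliesAt δ :=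
  primeTwoFamiliesAt_of_capacityGadgetsAt hδ (by positivity : (0 : ℝ) ≤ δ / 8)
    (by nlinarith [mul_pos hδ (by linarith : (0 : ℝ) < 2 - δ)]) (hC (δ / 8) (by positivity))

end Summit.MatrixMultiplication.MatrixMultiplication.Theorems.PrimeTwoFamilies.GadgetExchangeRate
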